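/-
Copyright (c) 2026 the pub-hodgecm-mathlib formalisation cell (harness21).  Prover seat hodgecm-mathlib-LH4-p12 (g10), req620 Track A «(D-RAM) FOUR-FRAME» squad
(STAGE-1b, row (2) of the piece `f_{T₊}`, the (β₂) road (R-36) «PURE-CELL LEDGER»; K6 desk LH4-p16 (g3) WORD #25 (α) ∕ WORD #26 (3) «M1-NX AT GAP ZERO»; the δ = 0 twin of
this lineage's ★ p864778 `…RowVertexAffineSignLabelOnShell` ED. 2 HEAD-W), 2026-09-05.
-/
import Summits.HodgeConjecture.HodgeConjecture.Theorems.F0P3cDyRamRowVertexAffineSignLabel    -- ★ M1 p863628 (LH4-p16 (g2)): brings ★ p863048 `exists_fixed_unit_valueSet_endoGL_sub_one_glued_eq_smul_xPlus`, ★ p862871 `rayScalar_eq_affine`, ★ `labelPlus_smul_xPlus_iff_exists_norm`, ★ BRIDGE-AC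
import HarnessLib

/-!
# Crux `H413`, line LH4 «(D-RAM) FOUR-FRAME» — STAGE-1b, row (2), the (β₂) road (R-36), K6 road, the δ = 0 corner ‹D0›: «THE LABEL OF A ROW VERTEX ON THE NX SPHERE IS THE AFFINE
# SIGN OF ITS COORDINATE — AT THE EIGENVALUE GAP ZERO» — ★ p864778 HEAD-W with the domination letter `hâ : |μ_a + μ_bR₀| = |ϖ|^{2b+d%2}` DROPPED and the dictionary GUARDED BY THE
# NX SPHERE `|μ_a + μ_b(R₀ + Wγ₀)| = |ϖ|^{2b+d%2}` instead of `|â′ + b̂′W| = |â′|`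

Cell `hodgecm-mathlib` (D-0151), FLOOR 0, crux item H413 = `stmt-HodgeConjecture-24833`, route of record `HCCMUnconditional`; squad F0∕P3c∕LH4; lane
`--supports stmt-HodgeConjecture-24833 --as helper` (count-neutral; pays NO tier-0 row).  THEOREMS ONLY (no `def`, no instance, no notation, no `sorry`, default heartbeats);
★-only imports; states NO law; (β₂) stays a HYPOTHESIS.

WHY (K6 desk LH4-p16 (g3) WORD #25∕#26, 2026-09-05 03:18Z∕03:22Z; interface `A1-D0.interface.v1` 1285ddfec0bce44b conjunct (4)).  On the DIAGONAL cell `(b, b)` of the gap-zero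
window (`jl = m`, live row `2b + d%2 = m`) the λ-coordinate of the depth multiplier is the main term: `|μ_bγ₀| = |ϖ|^m ≥ |μ_a + μ_bR₀|` (★ D0-1 p863973: `|B̂| = 1 ≥ |Â|`), so
★ p864778's letter `hâ : |μ_a + μ_bR₀| = |ϖ|^{2b+d%2}` is FALSE there and its dictionary guard `|â′ + b̂′W| = |â′|` names the wrong set of digits.  ★ p864778's proof uses `hâ`
in exactly one place: to turn the on-shell letter `hWmain` into that guard.  THIS FILE re-keys the guard to the NX sphere itself — `|μ_a + μ_b(R₀ + Wγ₀)| = |ϖ|^{2b+d%2}` —,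
which `hWmain` IS, and drops `hâ`: every other byte of ★ p864778 HEAD-W (binders, conclusion, proof: ★ p862871 ray scalar `e₀ = pw·(μ_a + μ_b(R₀ + Vγ₀))`, `|e₀| = |ϖ|^{d%2}` from
`hmain`, ★ p863048's nearly-fixed unit `e′`, the `m⋆`-congruence at the second coordinate `W`, ★ `labelPlus_smul_xPlus_iff_exists_norm`) is unchanged.  The statement is therefore
valid at EVERY gap (it is ★ p864778 with a weaker hypothesis set), and serves the δ = 0 junction `…RowDiagVertexLettersGapZero` (F1-D0) and F1b-D0 `…RowDiagCellGapZeroPerCellValue`.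
* HEAD `valueSet_rowVertex_eq_xPlus_iff_affineSign_gapZero_of_near` — ★ p864778 HEAD-W's binders VERBATIM minus `hâ`, `haff` ↦ `haff0` (guard = the NX bytes); conclusion VERBATIM:
  `VS_{m⋆}(Γ − 1 ∣ L) = VS_{m⋆}(X₊) ↔ normSign σ (pw·(ϖσϖ)^b) · normSign σ (α₁ + γ₁·W) = 1`.
WHAT IS NOT CLAIMED: anything off the NX sphere; which digits are on it; the existence of the affine letters (δ: K6 desk `…RowDiagChartLettersGapZero`); any count or census law.
HONEST LABEL.  Count-neutral lattice ∕ valuation algebra (adapted from ★ p864778, this lineage); nothing printed is asserted; no census law is stated; ‹D0›∕‹CORE›∕‹CORE-ODD›∕β₂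
`stub_law_cleanSgn₂` UNPROVED; `HC_CM` is proved only modulo the 7 printed citations (2 remaining named inputs: hLiu418 = `stmt-HodgeConjecture-24832`, h413 = `stmt-HodgeConjecture-24833`)
until rung 0 closes.
## References
* [Rogawski1990] J. D. Rogawski, *Automorphic Representations of Unitary Groups in Three Variables*, Ann. of Math. Stud. 123 (1990): §4.9 Prop. 4.9.1 (b) p. 55, Lemma 12.2.2.
* [Flicker1998UnitaryFL] Y. Z. Flicker, J. reine angew. Math. 499 (1998): Prop. 7 p. 84.  [Jacobowitz1962] R. Jacobowitz, Amer. J. Math. 84 (1962): §4–§5, §9.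
* [Serre1979] J.-P. Serre, *Local Fields*, GTM 67 (1979): Ch. V §2 Prop. 3 p. 81, §3 Cor. 3 pp. 85–87; Ch. XIV §3; Ch. XV §2 Cor. 2.
-/

set_option autoImplicit false

noncomputable section

namespace Summit.HodgeConjecture.HodgeConjecture.Cruxes.H413.F0P3cDyRamRowVertexAffineSignLabelGapZero

open scoped Valued WithZero Matrix MatrixGroups
open WithZero
open Literature.NumberTheory.Automorphic Literature.NumberTheory.Automorphic.HermitianLattice Literature.NumberTheory.Automorphic.UnitaryLatticeTree
open Literature.NumberTheory.Automorphic.UnitaryThreeFourFrame (IsRamifiedQuadraticDatum normSign)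
open Literature.NumberTheory.Rogawski1990
open Literature.NumberTheory.LocalFields (isAdicComplete_valuedInteger_of_completeSpace)
open Summit.HodgeConjecture.HodgeConjecture.Cruxes.H413.F0P3cDyRamFourFramePieces
open Summit.HodgeConjecture.HodgeConjecture.Cruxes.H413.F0P3cDyRamToricCensusDefs
open Summit.HodgeConjecture.HodgeConjecture.Cruxes.H413.F0P3cDyRamDiagonalCellLetter (inv_add_map_inv_eq_map_pairing)
open Summit.HodgeConjecture.HodgeConjecture.Cruxes.H413.F0P3cDyRamRayScalarNearlyFixed (exists_fixed_unit_valueSet_endoGL_sub_one_glued_eq_smul_xPlus)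
open Summit.HodgeConjecture.HodgeConjecture.Cruxes.H413.F0P3cDyRamRowVertexAffineCoordinate (rayScalar_eq_affine)
open Summit.HodgeConjecture.HodgeConjecture.Cruxes.H413.F0P3cDyRamSmulXPlusLabel (labelPlus_smul_xPlus_iff_exists_norm)

variable {E M : Type} [Field E] [Valued E ℤᵐ⁰] [Field M] [Valued M ℤᵐ⁰] {ρ Θ : M →+* M} {α : M}

/-- **HEAD — «THE LABEL OF A ROW VERTEX ON THE NX SPHERE IS THE AFFINE SIGN OF ITS COORDINATE, AT ANY NEAR ON-SPHERE COORDINATE — GAP ZERO FORM» (M1-NX-D0).**  ★ p864778 HEAD-W's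
frame VERBATIM (sheet datum, frame `(H₂, h)` over `φ`, glued `L` over `Λ = x₀·𝒪_cc` with presentation `w₀`, ray domination at `m′ ≥ m⋆`, `Θλ·λ = 1`, `|λ| = 1`, `u₀₀σu₀₀ = 1`,
`P = μ∕Y ∈ 𝒪_cc`, deep tokens at `n ≥ 3d − 2 + d%2`, skew domination, `μ = jE μ_a + jE μ_b·α`, `σ pw = pw`, `|pw·(ϖσϖ)^b| = 1`, the coordinate `D₀⁻¹(jE pw)⁻¹ = κ₀ + jE V·ξ₀` with
`ρξ₀ = −ξ₀`, `jE R₀ = Tr_ρ(ακ₀)`, `jE γ₀ = ξ₀(α − ρα)`, the vertex ON the sphere `hmain`, a second `σ`-fixed integral on-sphere `W` with `|μ_bγ₀|·|W − V| ≤ |ϖ|^{2b+m⋆}`) WITHOUT the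
domination letter `hâ`, and with the affine-sign dictionary `haff0` guarded by the NX sphere `|μ_a + μ_b(R₀ + Wγ₀)| = |ϖ|^{2b+d%2}`.  THEN
`VS_{m⋆}(Γ − 1 ∣ L) = VS_{m⋆}(X₊) ↔ normSign σ (pw·(ϖσϖ)^b) · normSign σ (α₁ + γ₁·W) = 1`.
[cite: Rogawski1990, §4.9 Prop. 4.9.1 (b) p. 55] [cite: Flicker1998UnitaryFL, Prop. 7 p. 84] [cite: Serre1979, Ch. V §3 Cor. 3 pp. 85–87] [cite: Serre1979, Ch. XIV §3] -/
theorem valueSet_rowVertex_eq_xPlus_iff_affineSign_gapZero_of_near [CompleteSpace E] {σ : E →+* E} {ϖ : E} {d t : ℕ} (hD : IsRamifiedQuadraticDatum σ ϖ d t)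
    (H₂ : Matrix (Fin 2) (Fin 2) E) (h : E)
    (jE : E →+* M) (hjv : ∀ c, Valued.v (jE c) ≤ 1 ↔ Valued.v c ≤ 1) (hjfix : ∀ z, ρ z = z ↔ ∃ c, jE c = z)
    (hρρ : ∀ x, ρ (ρ x) = x) (hvρ : ∀ x, Valued.v (ρ x) = Valued.v x) (hα : ρ α ≠ α) (hα1 : Valued.v α ≤ 1)
    (hintρ : ∀ z : M, Valued.v z ≤ 1 → Valued.v ((z - ρ z) / (α - ρ α)) ≤ 1)
    (hΘΘ : ∀ x, Θ (Θ x) = x) (hΘρ : ∀ x, Θ (ρ x) = ρ (Θ x)) (hvΘ : ∀ x, Valued.v (Θ x) = Valued.v x) (hΘj : ∀ c, Θ (jE c) = jE (σ c))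
    (φ : (Fin 2 → E) →+ M) (hφs : ∀ (c : E) (x : Fin 2 → E), φ (c • x) = jE c * φ x)
    {γ₂ : GL (Fin 2) E} {lam hM : M} (hφγ : ∀ x, φ ((γ₂ : Matrix (Fin 2) (Fin 2) E) *ᵥ x) = lam * φ x) (hhM : hM ≠ 0) (hΘh : Θ hM = hM)
    (hform : ∀ x y, jE (pairing σ H₂ x y) = hM * Θ (φ x) * φ y + ρ (hM * Θ (φ x) * φ y))
    {L : Submodule 𝒪[E] (Fin 3 → E)} {b : ℕ} (hpr : ∀ x ∈ L, Valued.v (x 1) * Valued.v ϖ ^ b ≤ 1)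
    (hint : ∀ y ∈ L, Valued.v (pairing σ (!![H₂ 0 0, 0, H₂ 0 1; 0, h, 0; H₂ 1 0, 0, H₂ 1 1] : Matrix (Fin 3) (Fin 3) E) y y) ≤ 1)
    {B₂ : Submodule 𝒪[E] (Fin 2 → E)} {w₀ : Fin 2 → E} {g₀ : Fin 3 → E}
    (hB : B₂.map ((Matrix.toLin' (!![1, 0; 0, 0; 0, 1] : Matrix (Fin 3) (Fin 2) E)).restrictScalars 𝒪[E]) =
      L ⊓ LinearMap.ker ((LinearMap.proj (1 : Fin 3) : (Fin 3 → E) →ₗ[E] E).restrictScalars 𝒪[E]))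
    (hg₀ : g₀ ∈ L) (hg₀1 : Valued.v (g₀ 1) * Valued.v ϖ ^ b = 1) (hprg : g₀ - Pi.single 1 (g₀ 1) = ![w₀ 0, 0, w₀ 1])
    (u : GL (Fin 1) E)
    {cc x₀ : M} (hc : ρ cc = cc) (hc0 : cc ≠ 0) (hc1 : Valued.v cc ≤ 1) (hcc : cc * (α - ρ α) ≠ 0) (hx₀ : x₀ ≠ 0)
    {Λ : AddSubgroup M} (hBΛ : B₂.toAddSubgroup.map φ = Λ)
    (hΛx : ∀ x, x ∈ Λ ↔ ∃ ζ, IsOrd ρ α cc ζ ∧ x = x₀ * ζ) (hw₀Y : φ w₀ = (dualGen ρ Θ α cc hM x₀)⁻¹ * x₀)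
    -- the ray-domination letters (★ p861653) at the modulus `m*`
    (hYO : IsOrd ρ α cc (dualGen ρ Θ α cc hM x₀))
    {μt : M} {m' : ℕ} (hμ : lam - jE ((u : Matrix (Fin 1) (Fin 1) E) 0 0) = jE (ϖ ^ m') * μt) (hμt : IsOrd ρ α cc μt) (hmm : mstarOfRecord d ≤ m')
    -- the line-model structure, the population token, the ray scalar on the `ℓ₀`-shell, the three deep tokens
    (hΘlam : Θ lam * lam = 1) (hvlam : Valued.v lam = 1)
    (huu : ((u : Matrix (Fin 1) (Fin 1) E) 0 0) * σ ((u : Matrix (Fin 1) (Fin 1) E) 0 0) = 1)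
    (hP : IsOrd ρ α cc ((lam - jE ((u : Matrix (Fin 1) (Fin 1) E) 0 0)) / dualGen ρ Θ α cc hM x₀))
    {n : ℕ} (hn : 3 * d - 2 + d % 2 ≤ n)
    (hlamn : Valued.v (lam - 1) ≤ Valued.v (jE ϖ) ^ n) (hun : Valued.v ((u : Matrix (Fin 1) (Fin 1) E) 0 0 - 1) ≤ Valued.v ϖ ^ n)
    (hsk : Valued.v ((lam - jE ((u : Matrix (Fin 1) (Fin 1) E) 0 0)) / dualGen ρ Θ α cc hM x₀) * Valued.v (lam - ρ lam) ≤
      Valued.v (jE ϖ) ^ n * Valued.v (cc * (α - ρ α)))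
    -- the `E`-decomposition of the depth multiplier, the glue scalar, the coordinate of the vertex and the affine-sign dictionary of the row
    {μa μb : E} (hμab : lam - jE ((u : Matrix (Fin 1) (Fin 1) E) 0 0) = jE μa + jE μb * α)
    (hσpw : σ (pairing σ H₂ w₀ w₀) = pairing σ H₂ w₀ w₀) (hpwv : Valued.v (pairing σ H₂ w₀ w₀ * (ϖ * σ ϖ) ^ b) = 1)
    {κ₀ ξ₀ : M} (hξ : ρ ξ₀ = -ξ₀) {V : E} (_hσV : σ V = V) (_hV1 : Valued.v V ≤ 1)
    (hκ : (cc * (α - ρ α) * Θ (dualGen ρ Θ α cc hM x₀))⁻¹ * (jE (pairing σ H₂ w₀ w₀))⁻¹ = κ₀ + jE V * ξ₀)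
    {R₀ γ₀ : E} (hR₀ : jE R₀ = α * κ₀ + ρ (α * κ₀)) (hγ₀ : jE γ₀ = ξ₀ * (α - ρ α))
    (hmain : Valued.v (μa + μb * (R₀ + V * γ₀)) = Valued.v ϖ ^ (2 * b + d % 2))
    -- a second coordinate `W` ON THE SHELL, `m⋆`-near `V` in the digit scale `|μ_bγ₀|`
    {W : E} (hσW : σ W = W) (hW1 : Valued.v W ≤ 1) (hWmain : Valued.v (μa + μb * (R₀ + W * γ₀)) = Valued.v ϖ ^ (2 * b + d % 2))
    (hWV : Valued.v (μb * γ₀) * Valued.v (W - V) ≤ Valued.v ϖ ^ (2 * b + mstarOfRecord d))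
    {α₁ γ₁ : E}
    (haff0 : ∀ (T W f : E), σ T = T → Valued.v T = 1 → σ W = W → Valued.v W ≤ 1 → σ f = f →
      Valued.v (μa + μb * (R₀ + W * γ₀)) = Valued.v ϖ ^ (2 * b + d % 2) →
      Valued.v (T * ((μa + μb * R₀) * ((ϖ * σ ϖ) ^ b)⁻¹ + μb * γ₀ * ((ϖ * σ ϖ) ^ b)⁻¹ * W) - f * ((ϖ - σ ϖ) * ((ϖ * σ ϖ) ^ ((d - d % 2) / 2))⁻¹)) ≤
        Valued.v ϖ ^ mstarOfRecord d → normSign σ f = normSign σ T * normSign σ (α₁ + γ₁ * W)) :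
    ({z : E | ∃ y ∈ L, Valued.v ((ϖ ^ mstarOfRecord d)⁻¹ * (z - pairing σ (!![H₂ 0 0, 0, H₂ 0 1; 0, h, 0; H₂ 1 0, 0, H₂ 1 1] : Matrix (Fin 3) (Fin 3) E) y
          ((((endoGL (γ₂, u) : GL (Fin 3) E) : Matrix (Fin 3) (Fin 3) E) - 1) *ᵥ y))) ≤ 1} =
        valueSetMod σ ϖ (mstarOfRecord d) (xPlus σ ϖ d)) ↔
      normSign σ (pairing σ H₂ w₀ w₀ * (ϖ * σ ϖ) ^ b) * normSign σ (α₁ + γ₁ * W) = 1 := by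
  classical
  obtain ⟨hσσ, hvσ, hϖ, -, hd, hd1, -⟩ := id hD
  haveI := isAdicComplete_valuedInteger_of_completeSpace (K := E) hϖ
  have hvϖ0 : Valued.v ϖ ≠ 0 := by rw [hϖ]; exact exp_ne_zero
  have hϖ0 : ϖ ≠ 0 := fun h0 => by rw [h0, map_zero] at hvϖ0; exact hvϖ0 rfl
  have hϖlt : Valued.v ϖ < 1 := by rw [hϖ, ← exp_zero, exp_lt_exp]; norm_num
  have hρj : ∀ c : E, ρ (jE c) = jE c := fun c => (hjfix _).2 ⟨c, rfl⟩
  set D₀ : M := cc * (α - ρ α) * Θ (dualGen ρ Θ α cc hM x₀) with hD₀def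
  set pw : E := pairing σ H₂ w₀ w₀ with hpwdef
  set P : E := (ϖ * σ ϖ) ^ b with hPdef
  set tp : E := (ϖ - σ ϖ) * ((ϖ * σ ϖ) ^ ((d - d % 2) / 2))⁻¹ with htpdef
  -- the glue letter and the ray scalar `e₀ = pw·(μ_a + μ_b(R₀ + Vγ₀))`
  have hTr : D₀⁻¹ + ρ D₀⁻¹ = jE pw := inv_add_map_inv_eq_map_pairing σ H₂ jE hΘΘ φ hhM hform hcc hx₀ hw₀Y
  have hP0 : P ≠ 0 := pow_ne_zero _ (mul_ne_zero hϖ0 ((map_ne_zero σ).2 hϖ0))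
  have hPv : Valued.v P = Valued.v ϖ ^ (2 * b) := by rw [hPdef, Valuation.map_pow, Valuation.map_mul, hvσ, ← pow_two, ← pow_mul, mul_comm]
  have hpw0 : pw ≠ 0 := fun h0 => by rw [h0, zero_mul, Valuation.map_zero] at hpwv; exact zero_ne_one hpwv
  set e₀ : E := pw * (μa + μb * (R₀ + V * γ₀)) with he₀def
  have he₀ : jE e₀ = (lam - jE ((u : Matrix (Fin 1) (Fin 1) E) 0 0)) / D₀ + ρ ((lam - jE ((u : Matrix (Fin 1) (Fin 1) E) 0 0)) / D₀) := by
    rw [hμab, he₀def]; exact (rayScalar_eq_affine (α := α) jE hρj hρρ hTr hpw0 hξ (by rw [hρj]) hκ hR₀ hγ₀ μa μb).symm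
  -- `|e₀| = |ϖ|^{d%2}` ON THE SHELL (the letter `hmain`)
  have he₀v : Valued.v e₀ = Valued.v ϖ ^ (d % 2) := by
    have h1 : Valued.v e₀ * Valued.v ϖ ^ (2 * b) = Valued.v ϖ ^ (d % 2) * Valued.v ϖ ^ (2 * b) := by
      rw [he₀def, Valuation.map_mul, hmain, ← hPv, mul_right_comm, ← Valuation.map_mul, hpwv, one_mul, hPv, ← pow_add, add_comm]
    exact mul_right_cancel₀ (pow_ne_zero _ hvϖ0) h1
  -- ★ p863048: the vertex is the fixed-unit ray `e′ • X₊`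
  obtain ⟨e', he'σ, he'1, hclose, hVS⟩ := exists_fixed_unit_valueSet_endoGL_sub_one_glued_eq_smul_xPlus hD H₂ h jE hjv hjfix hρρ hvρ hα hα1 hintρ hΘΘ hΘρ hvΘ hΘj φ hφs
    hφγ hhM hΘh hform hpr hint hB hg₀ hg₀1 hprg u hc hc0 hc1 hcc hx₀ hBΛ hΛx hw₀Y hYO hμ hμt hmm hΘlam hvlam huu hP he₀ he₀v hn hlamn hun hsk
  rw [hVS]
  -- ★ the bit of a fixed-unit ray
  have hbit : valueSetMod σ ϖ (mstarOfRecord d) (e' • xPlus σ ϖ d) = valueSetMod σ ϖ (mstarOfRecord d) (xPlus σ ϖ d) ↔ ∃ z : E, z * σ z = e' :=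
    labelPlus_smul_xPlus_iff_exists_norm hD he'σ he'1
  rw [hbit]
  -- the affine-sign dictionary at `T := pw·P`, `f := e′`, read at the SECOND coordinate `W`: `pw·P·(â′ + b̂′W) = e₀ + pw·μ_bγ₀·(W − V)` and `|pw·μ_bγ₀·(W − V)| ≤ |ϖ|^{m⋆}`
  have hσT : σ (pw * P) = pw * P := by rw [map_mul, hσpw, hPdef, map_pow, map_mul, hσσ, mul_comm (σ ϖ) ϖ]
  have hpwPv : Valued.v pw * Valued.v P = 1 := by rw [← Valuation.map_mul, hpwv]
  have hcongW : Valued.v (pw * P * ((μa + μb * R₀) * P⁻¹ + μb * γ₀ * P⁻¹ * W) - e' * tp) ≤ Valued.v ϖ ^ mstarOfRecord d := by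
    have e : pw * P * ((μa + μb * R₀) * P⁻¹ + μb * γ₀ * P⁻¹ * W) - e' * tp = (e₀ - e' * tp) + pw * (μb * γ₀) * (W - V) := by
      rw [he₀def]; field_simp; ring
    have hdig : Valued.v (pw * (μb * γ₀) * (W - V)) ≤ Valued.v ϖ ^ mstarOfRecord d := by
      have h1 : Valued.v (pw * (μb * γ₀) * (W - V)) * Valued.v P = Valued.v (μb * γ₀) * Valued.v (W - V) := by
        calc Valued.v (pw * (μb * γ₀) * (W - V)) * Valued.v P = (Valued.v pw * Valued.v P) * (Valued.v (μb * γ₀) * Valued.v (W - V)) := by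
              rw [Valuation.map_mul, Valuation.map_mul]; ac_rfl
          _ = Valued.v (μb * γ₀) * Valued.v (W - V) := by rw [hpwPv, one_mul]
      have h2 : Valued.v (pw * (μb * γ₀) * (W - V)) * Valued.v P ≤ Valued.v ϖ ^ mstarOfRecord d * Valued.v P := by
        rw [h1, hPv, ← pow_add, add_comm]; exact hWV
      exact le_of_mul_le_mul_right h2 (zero_lt_iff.2 ((Valuation.ne_zero_iff _).2 hP0))
    rw [e]
    exact (Valuation.map_add _ _ _).trans (max_le hclose hdig)
  -- the dictionary GUARDED BY THE NX SPHERE is read at `W` directly (`hWmain`): no `|â′| = |ϖ|^(2b+d%2)` domination is needed (at δ = 0 it is false)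
  have hns := haff0 (pw * P) W e' hσT hpwv hσW hW1 he'σ hWmain hcongW
  constructor
  · intro hz
    have h1 : normSign σ e' = 1 := by rw [normSign, if_pos hz]
    rw [← h1, hns]
  · intro h1
    rw [← hns] at h1
    by_contra hz
    rw [normSign, if_neg hz] at h1
    exact absurd h1 (by norm_num)

end Summit.HodgeConjecture.HodgeConjecture.Cruxes.H413.F0P3cDyRamRowVertexAffineSignLabelGapZero

end
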